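/-
Copyright (c) 2026 the pub-hodgecm-mathlib formalisation cell (harness21).  Prover seat hodgecm-mathlib-K2Liu-p09 (g6): Track B «K2-LIT»,
hLiu418 = stmt-HodgeConjecture-24832; LEAD F0P6-plan RULING M-158d «A7-val road (σ)», instance layer I-3b (the partner laws `h𝒜G`, `hωG` of the (A4″-KR) instance).
-/
import Summits.HodgeConjecture.HodgeConjecture.Theorems.K2LiuA7ValueInstanceDefs            -- ★ I-2 (`rhoLoc`, `partnerBlkDHom`; brings ★ I-0 bridge, ★ I-1b blocks)
import Summits.HodgeConjecture.HodgeConjecture.Theorems.K2LiuDeltaSpTransportSiegelJunction  -- ★ A2d junction (`proj_transport_eq`; brings ★ A2c, ★ β-1, ★ β-3)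
import Summits.HodgeConjecture.HodgeConjecture.Theorems.K2LiuSWSectionKPrimeAverage          -- ★ (A4-avg) (K2Liu-p11): `swSectionDelta_toRep_eq_mul_of_commute`
import HarnessLib

/-!
# Crux `HLiu418`, road `K2_Liu`, organ A7-val, instance layer I-3b: THE PARTNER LAWS — `f^Δ_{L(ρ g)Φ} = f^Δ_Φ` (`h𝒜G`) AND `ω(h) L(ρ g) = L(ρ g) ω(h)` (`hωG`)

Cell `hodgecm-mathlib`, crux item hLiu418 = `stmt-HodgeConjecture-24832`; squad K2 ∕ K2Liu; prover K2Liu-p09 (g6), organ lead A7-val.  THEOREMS ONLY; lane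
`--supports stmt-HodgeConjecture-24832` (count-neutral helper).  Setting of ★ I-3a: the K2Lit CM datum `(L, e, dV, dW)`, `V′ = (L^{M₂}, diag dV′)`, tensor frames
`(eW, e′)`, finite place `v`, a CM-model splitting `s_𝔻` of the BIG group `U(𝔻 ⊗ V′)(L⁺_v)` over `ι` (binder `hsproj`) and a Δ-intertwiner `Γ` (★ β-3);
`s^Δ_B := mpTransportLoc Γ ∘ s_𝔻 ∘ tensorEmbLoc` over `H_v`, and the partner pairs `p_g := mpTransportLoc Γ (s_𝔻 (1 ⊗ g))`, `g ∈ U(V′_v)`.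
* §1 `exists_proj_transport_partnerEmbLoc_eq_leviSp`: `proj p_g = leviSp (ρ g) d` (★ I-0 bridge at the block-diagonal `1 ⊗ g`, ★ I-1b, ★ A2d `proj_transport_eq`);
  **`exists_toRep_partner_eq_smul`**: `ω^Δ(p_g) = c_g • leviEquivSB (ρ g)`, `c_g ∈ ℂˣ` (★ A2c `exists_toRep_eq_smul_leviEquivSB`); `commute_partner_transport`:
  `p_g` commutes with every `s^Δ_B h` (the dual pair commutes, ★ I-1b).
* §2 **`swSectionDelta_leviEquivSB_rhoLoc`** — THE BINDER `h𝒜G` of ★ V8e at the instance: `f^Δ_{L(ρ g) Φ}(h) = f^Δ_Φ(h)` (★ (A4-avg) `swSectionDelta_toRep_eq_mul_of_commute`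
  divided by `c_g`); **`toRep_transport_leviEquivSB_rhoLoc`** — THE BINDER `hωG`: `ω^Δ(s^Δ_B h) (L(ρ g) Φ) = L(ρ g) (ω^Δ(s^Δ_B h) Φ)`.
HONEST LABEL.  `HC_CM` is proved only modulo the 7 printed citations (2 remaining named inputs: hLiu418 = `stmt-HodgeConjecture-24832`,
h413 = `stmt-HodgeConjecture-24833`) until rung 0 closes.

## References
* [Kudla1994] S. Kudla, Israel J. Math. 87 (1994), §3 Thm. 3.1.
* [MoeglinVignerasWaldspurger1987] C. Mœglin, M.-F. Vignéras, J.-L. Waldspurger, LNM 1291, Chap. 1 I.17 (dual pairs commute), Chap. 2 II.1 (B), II.6.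
* [KudlaRallis1994] S. Kudla, S. Rallis, Ann. of Math. 140 (1994), §1 (the Siegel–Weil section `Φ ↦ f_Φ`).
-/

set_option autoImplicit false
set_option linter.dupNamespace false -- the mandated namespace repeats `HodgeConjecture.HodgeConjecture`

noncomputable section

open scoped Matrix Kronecker
open NumberField IsDedekindDomain Matrix Topology
open Literature.NumberTheory.Automorphic Literature.NumberTheory.Automorphic.UnitaryGroup
open Literature.NumberTheory.GelbartRogawski1991 Literature.NumberTheory.GelbartRogawski1991.GRConstruction
open Literature.NumberTheory.GelbartRogawski1991.UnitaryDualPair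
open Literature.NumberTheory.GelbartRogawski1991.UnitaryDualPair.LocalSplitting
open Literature.NumberTheory.GelbartRogawski1991.AdaptedBlocks
open Literature.NumberTheory.K2Lit.SiegelDoubled
open Literature.RepresentationTheory.HeisenbergGroup
open Summit.HodgeConjecture.HodgeConjecture.Cruxes.HLiu418.K2LiuLocalSWSectionDefs
open Summit.HodgeConjecture.HodgeConjecture.Cruxes.HLiu418.K2LiuLocalSWTensorAdaptedBlocks
open Summit.HodgeConjecture.HodgeConjecture.Cruxes.HLiu418.K2LiuDoublingSchrodingerModelDefs
open Summit.HodgeConjecture.HodgeConjecture.Cruxes.HLiu418.K2LiuDoublingModelComparison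
open Summit.HodgeConjecture.HodgeConjecture.Cruxes.HLiu418.K2LiuKudlaRallisMapDeltaModel
open Summit.HodgeConjecture.HodgeConjecture.Cruxes.HLiu418.K2LiuDeltaSpTransportSiegelJunction
open Summit.HodgeConjecture.HodgeConjecture.Cruxes.HLiu418.K2LiuDeltaModelRealFrame
open Summit.HodgeConjecture.HodgeConjecture.Cruxes.HLiu418.K2LiuA7ValuePartnerBlocks
open Summit.HodgeConjecture.HodgeConjecture.Cruxes.HLiu418.K2LiuA7ValueInstanceDefs
open Summit.HodgeConjecture.HodgeConjecture.Cruxes.HLiu418.K2LiuSWSectionKPrimeAverage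

namespace Summit.HodgeConjecture.HodgeConjecture.Cruxes.HLiu418.K2LiuA7ValueInstancePartnerLaws

variable (L : Type) [Field L] [NumberField L] [IsCMField L]
variable {N M n : ℕ} (e : Fin N × Fin M ≃ Fin n)
  (dV : Fin N → L) (hdV : ∀ i, IsCMField.complexConj L (dV i) = dV i) (hdV0 : ∀ i, dV i ≠ 0)
  (dW : Fin M → L) (hdW : ∀ i, IsCMField.complexConj L (dW i) = dW i) (hdW0 : ∀ i, dW i ≠ 0)
variable {M₂ M' n' : ℕ} (eW : Fin M × Fin M₂ ≃ Fin M') (e' : Fin N × Fin M' ≃ Fin n')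
  (dV' : Fin M₂ → L) (hdV' : ∀ k, IsCMField.complexConj L (dV' k) = dV' k) (hdV'0 : ∀ k, dV' k ≠ 0)
variable (v : HeightOneSpectrum (𝓞 (Fp L)))
  (Γ : SchwartzBruhat (Fin (n' + n') → v.adicCompletion (Fp L)) ≃ₗ[ℂ] SchwartzBruhat (Fin (n' + n') → v.adicCompletion (Fp L)))
  (hΓ : IsDeltaIntertwiner L e' dV hdV (tensorFrame L dW eW dV') (tensorFrame_real L dW hdW eW dV' hdV') v Γ)
  (s𝔻 : UnitaryGroup.localPi L (IsCMField.complexConj L) (n' + n') (hermD L e' dV hdV (tensorFrame L dW eW dV') (tensorFrame_real L dW hdW eW dV' hdV')) v →*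
    LocalMp (Fp L) (n' + n') (gramD L e' dV hdV (tensorFrame L dW eW dV') (tensorFrame_real L dW hdW eW dV' hdV')) v)
  (hsproj : ∀ g, MpPsi.proj _ (s𝔻 g) =
    iotaD (Fp L) L (IsCMField.complexConj L) (complexConj_imagUnit L) (imagUnit_ne_zero L) (imagUnit_mul_self L) v n'
      (gramR_isSymm L e' dV hdV (tensorFrame L dW eW dV') (tensorFrame_real L dW hdW eW dV' hdV'))
      (hermD_eq_map_gramD L e' dV hdV (tensorFrame L dW eW dV') (tensorFrame_real L dW hdW eW dV' hdV')) g)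

/-! ## §0 A scalar multiple of an operator commuting with `B` commutes with `B` (abstract) -/

/-- if `A B = B A` and `T = a • A` pointwise then `B (T Φ) = T (B Φ)`. [folklore] -/
theorem apply_comm_of_eq_smul {V : Type*} [AddCommGroup V] [Module ℂ V] (A B : Module.End ℂ V) (hAB : A * B = B * A)
    (T : V ≃ₗ[ℂ] V) (a : ℂ) (hT : ∀ Ψ, T Ψ = a • A Ψ) (Φ : V) : B (T Φ) = T (B Φ) := by
  have h3 : A (B Φ) = B (A Φ) := (Module.End.mul_apply A B Φ).symm.trans ((LinearMap.congr_fun hAB Φ).trans (Module.End.mul_apply B A Φ))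
  rw [hT, hT, LinearMap.map_smul, h3]

/-! ## §1 The partner pairs `p_g` -/

/-- each `ρ g = rhoLoc v g` is continuous with continuous inverse (★ I-0 read through ★ I-2 `rhoLoc_apply`). [folklore] -/
theorem continuous_rhoLoc (g : UnitaryGroup.localPi L (IsCMField.complexConj L) M₂ (Matrix.diagonal dV') v) :
    Continuous (rhoLoc L (complexConj_imagUnit L) (imagUnit_ne_zero L) e dV hdV dW hdW eW e' dV' hdV' v g) ∧
      Continuous (rhoLoc L (complexConj_imagUnit L) (imagUnit_ne_zero L) e dV hdV dW hdW eW e' dV' hdV' v g).symm := by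
  rw [rhoLoc_apply]
  exact ⟨continuous_leviAct (Fp L) L (IsCMField.complexConj L) (complexConj_imagUnit L) (imagUnit_ne_zero L) v n' _,
    continuous_leviAct_symm (Fp L) L (IsCMField.complexConj L) (complexConj_imagUnit L) (imagUnit_ne_zero L) v n' _⟩

set_option maxHeartbeats 800000 in -- measured (as ★ I-3a): matching the (A2d) and (β-1) currencies of the `ℓ_Δ`-pairing unfolds `deltaGramLoc ∕ gramRLoc`
include hdV0 hdW0 hdV'0 hsproj in
/-- the symplectic part of `p_g = mpTransportLoc Γ (s_𝔻 (1 ⊗ g))` is the Levi letter `leviSp (ρ g) d` (★ A2d `proj_transport_eq`; `1 ⊗ g` is block-diagonal, ★ I-1b,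
so the ★ I-0 bridge applies). [cite: Kudla1994, §3] [cite: MoeglinVignerasWaldspurger1987, Chap. 2 II.1 (B), II.6] -/
theorem exists_proj_transport_partnerEmbLoc_eq_leviSp (g : UnitaryGroup.localPi L (IsCMField.complexConj L) M₂ (Matrix.diagonal dV') v) :
    ∃ (d : (Fin (n' + n') → v.adicCompletion (Fp L)) ≃ₗ[v.adicCompletion (Fp L)] (Fin (n' + n') → v.adicCompletion (Fp L)))
      (had : ∀ x y : Fin (n' + n') → v.adicCompletion (Fp L),
        Matrix.toLinearMap₂' (v.adicCompletion (Fp L)) (deltaGramLoc L e' dV hdV (tensorFrame L dW eW dV') (tensorFrame_real L dW hdW eW dV' hdV') v)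
            (rhoLoc L (complexConj_imagUnit L) (imagUnit_ne_zero L) e dV hdV dW hdW eW e' dV' hdV' v g x) (d y) =
          Matrix.toLinearMap₂' (v.adicCompletion (Fp L)) (deltaGramLoc L e' dV hdV (tensorFrame L dW eW dV') (tensorFrame_real L dW hdW eW dV' hdV') v) x y),
      MpPsi.proj (localSchrodingerDelta L e' dV hdV (tensorFrame L dW eW dV') (tensorFrame_real L dW hdW eW dV' hdV') v)
          (mpTransportLoc L e' dV hdV (tensorFrame L dW eW dV') (tensorFrame_real L dW hdW eW dV' hdV') v Γ hΓ
            (s𝔻 (partnerEmbLoc L e dV hdV dW hdW eW e' dV' hdV' v g))) =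
        leviSp _ (rhoLoc L (complexConj_imagUnit L) (imagUnit_ne_zero L) e dV hdV dW hdW eW e' dV' hdV' v g) d had := by
  obtain ⟨d, had, heq⟩ := exists_deltaTransport_iotaD_eq_leviSp_leviAct (Fp L) L (IsCMField.complexConj L) (complexConj_imagUnit L) (imagUnit_ne_zero L) v n'
    (imagUnit_mul_self L) (gramR_isSymm L e' dV hdV (tensorFrame L dW eW dV') (tensorFrame_real L dW hdW eW dV' hdV'))
    (isUnit_det_gramR₀ L e' dV hdV hdV0 (tensorFrame L dW eW dV') (tensorFrame_real L dW hdW eW dV' hdV') (tensorFrame_ne_zero L dW eW dV' hdW0 hdV'0))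
    (hermD_eq_map_gramD L e' dV hdV (tensorFrame L dW eW dV') (tensorFrame_real L dW hdW eW dV' hdV'))
    (partnerEmbLoc L e dV hdV dW hdW eW e' dV' hdV' v g)
    (blk_matA_partnerEmbLoc L e dV hdV dW hdW eW e' dV' hdV' v g).2.1 (blkC_partnerEmbLoc_eq_zero L e dV hdV dW hdW eW e' dV' hdV' v g)
    (partnerBlkDHom L e dV hdV dW hdW eW e' dV' hdV' v g)
    (by
      show (blkDGL (Fp L) L (IsCMField.complexConj L) v n' (partnerEmbLoc L e dV hdV dW hdW eW e' dV' hdV' v g)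
        (blkC_partnerEmbLoc_eq_zero L e dV hdV dW hdW eW e' dV' hdV' v g)).val = _
      rw [val_blkDGL])
  have key := proj_transport_eq L e' dV hdV (tensorFrame L dW eW dV') (tensorFrame_real L dW hdW eW dV' hdV') v Γ hΓ s𝔻 hsproj
    (partnerEmbLoc L e dV hdV dW hdW eW e' dV' hdV' v g)
  exact ⟨d, had, key.trans heq⟩

set_option maxHeartbeats 800000 in -- measured (as ★ I-3a)
include hdV0 hdW0 hdV'0 hsproj in
/-- **THE PARTNER PAIRS ACT BY SCALAR MULTIPLES OF WEIL's `d₀(ρ g)`**: `ω^Δ(p_g) = c_g • leviEquivSB (ρ g)` with `c_g ∈ ℂˣ` (★ A2c `exists_toRep_eq_smul_leviEquivSB`,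
implementers unique up to scalars ★ `implementerUniqueUpToScalar_localSchrodingerDelta`). [cite: Kudla1994, §3 Thm. 3.1] [cite: MoeglinVignerasWaldspurger1987, Chap. 2 II.1 (B), II.6] -/
theorem exists_toRep_partner_eq_smul (g : UnitaryGroup.localPi L (IsCMField.complexConj L) M₂ (Matrix.diagonal dV') v) :
    ∃ c : ℂˣ, ∀ Φ : SchwartzBruhat (Fin (n' + n') → v.adicCompletion (Fp L)),
      MpPsi.toRep (localSchrodingerDelta L e' dV hdV (tensorFrame L dW eW dV') (tensorFrame_real L dW hdW eW dV' hdV') v)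
          (mpTransportLoc L e' dV hdV (tensorFrame L dW eW dV') (tensorFrame_real L dW hdW eW dV' hdV') v Γ hΓ
            (s𝔻 (partnerEmbLoc L e dV hdV dW hdW eW e' dV' hdV' v g))) Φ =
        (c : ℂ) • leviEquivSB (rhoLoc L (complexConj_imagUnit L) (imagUnit_ne_zero L) e dV hdV dW hdW eW e' dV' hdV' v g)
          (continuous_rhoLoc L e dV hdV dW hdW eW e' dV' hdV' v g).1 (continuous_rhoLoc L e dV hdV dW hdW eW e' dV' hdV' v g).2 Φ := by
  obtain ⟨d, had, hp⟩ := exists_proj_transport_partnerEmbLoc_eq_leviSp L e dV hdV hdV0 dW hdW hdW0 eW e' dV' hdV' hdV'0 v Γ hΓ s𝔻 hsproj g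
  exact exists_toRep_eq_smul_leviEquivSB
    (Matrix.toLinearMap₂' (v.adicCompletion (Fp L)) (deltaGramLoc L e' dV hdV (tensorFrame L dW eW dV') (tensorFrame_real L dW hdW eW dV' hdV') v))
    (adeleAddCharAt (Fp L) v) (isLocallyConstant_of_isContinuousNontrivial (isContinuousNontrivial_adeleAddCharAt (Fp L) v))
    (K2LiuDoublingSchrodingerModelDefs.continuous_toLinearMap₂'_left L (deltaGramLoc L e' dV hdV (tensorFrame L dW eW dV') (tensorFrame_real L dW hdW eW dV' hdV') v))
    (K2LiuKudlaRallisMapDeltaModel.implementerUniqueUpToScalar_localSchrodingerDelta L e' dV hdV hdV0 (tensorFrame L dW eW dV')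
      (tensorFrame_real L dW hdW eW dV' hdV') (tensorFrame_ne_zero L dW eW dV' hdW0 hdV'0) v)
    _ d had _ _ _ hp

/-- **the partner pairs commute with the face's splitting over `H_v`**: `p_g · s^Δ_B(h) = s^Δ_B(h) · p_g` (the dual pair commutes, ★ I-1b, pushed through the
homomorphism `mpTransportLoc Γ ∘ s_𝔻`). [cite: MoeglinVignerasWaldspurger1987, Chap. 1 I.17] -/
theorem commute_partner_transport (g : UnitaryGroup.localPi L (IsCMField.complexConj L) M₂ (Matrix.diagonal dV') v)
    (h : UnitaryGroup.localPi L (IsCMField.complexConj L) (n + n) (hermD L e dV hdV dW hdW) v) :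
    Commute
      (mpTransportLoc L e' dV hdV (tensorFrame L dW eW dV') (tensorFrame_real L dW hdW eW dV' hdV') v Γ hΓ
        (s𝔻 (partnerEmbLoc L e dV hdV dW hdW eW e' dV' hdV' v g)))
      (((mpTransportLoc L e' dV hdV (tensorFrame L dW eW dV') (tensorFrame_real L dW hdW eW dV' hdV') v Γ hΓ).toMonoidHom.comp
        (s𝔻.comp (tensorEmbLoc L e dV hdV dW hdW eW e' dV' hdV' v))) h) :=
  ((commute_tensorEmbLoc_partnerEmbLoc L e dV hdV dW hdW eW e' dV' hdV' v h g).symm.map s𝔻).map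
    (mpTransportLoc L e' dV hdV (tensorFrame L dW eW dV') (tensorFrame_real L dW hdW eW dV' hdV') v Γ hΓ).toMonoidHom

/-! ## §2 The laws `h𝒜G` and `hωG` -/

set_option maxHeartbeats 800000 in -- measured (as ★ I-3a)
include hdV0 hdW0 hdV'0 hsproj in
/-- **`h𝒜G` AT THE INSTANCE: `f^Δ_{L(ρ g) Φ}(h) = f^Δ_Φ(h)`** for every `g ∈ U(V′_v)`, `Φ ∈ 𝒮(X_Δ)`, `h ∈ H_v` — the Siegel–Weil section through the face's splitting
`s^Δ_B` is INVARIANT under Weil's operators of the partner group (★ (A4-avg) `swSectionDelta_toRep_eq_mul_of_commute` at `p_g`, divided by `c_g`).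
[cite: KudlaRallis1994, §1] [cite: MoeglinVignerasWaldspurger1987, Chap. 1 I.17, Chap. 2 II.6] -/
theorem swSectionDelta_leviEquivSB_rhoLoc (g : UnitaryGroup.localPi L (IsCMField.complexConj L) M₂ (Matrix.diagonal dV') v)
    (Φ : SchwartzBruhat (Fin (n' + n') → v.adicCompletion (Fp L))) (h : UnitaryGroup.localPi L (IsCMField.complexConj L) (n + n) (hermD L e dV hdV dW hdW) v) :
    swSectionDelta L e' dV hdV (tensorFrame L dW eW dV') (tensorFrame_real L dW hdW eW dV' hdV') v
        ((mpTransportLoc L e' dV hdV (tensorFrame L dW eW dV') (tensorFrame_real L dW hdW eW dV' hdV') v Γ hΓ).toMonoidHom.comp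
          (s𝔻.comp (tensorEmbLoc L e dV hdV dW hdW eW e' dV' hdV' v)))
        (leviEquivSB (rhoLoc L (complexConj_imagUnit L) (imagUnit_ne_zero L) e dV hdV dW hdW eW e' dV' hdV' v g)
          (continuous_rhoLoc L e dV hdV dW hdW eW e' dV' hdV' v g).1 (continuous_rhoLoc L e dV hdV dW hdW eW e' dV' hdV' v g).2 Φ) h =
      swSectionDelta L e' dV hdV (tensorFrame L dW eW dV') (tensorFrame_real L dW hdW eW dV' hdV') v
        ((mpTransportLoc L e' dV hdV (tensorFrame L dW eW dV') (tensorFrame_real L dW hdW eW dV' hdV') v Γ hΓ).toMonoidHom.comp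
          (s𝔻.comp (tensorEmbLoc L e dV hdV dW hdW eW e' dV' hdV' v))) Φ h := by
  obtain ⟨c, hc⟩ := exists_toRep_partner_eq_smul L e dV hdV hdV0 dW hdW hdW0 eW e' dV' hdV' hdV'0 v Γ hΓ s𝔻 hsproj g
  -- `ω^Δ(p_g) Ψ (0) = c · Ψ(0)`
  have hp0 : ∀ Ψ : SchwartzBruhat (Fin (n' + n') → v.adicCompletion (Fp L)),
      ((MpPsi.toRep (localSchrodingerDelta L e' dV hdV (tensorFrame L dW eW dV') (tensorFrame_real L dW hdW eW dV' hdV') v)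
          (mpTransportLoc L e' dV hdV (tensorFrame L dW eW dV') (tensorFrame_real L dW hdW eW dV' hdV') v Γ hΓ
            (s𝔻 (partnerEmbLoc L e dV hdV dW hdW eW e' dV' hdV' v g))) Ψ : SchwartzBruhat (Fin (n' + n') → v.adicCompletion (Fp L))) :
          (Fin (n' + n') → v.adicCompletion (Fp L)) → ℂ) 0 = (c : ℂ) * (Ψ : (Fin (n' + n') → v.adicCompletion (Fp L)) → ℂ) 0 := fun Ψ => by
    rw [hc Ψ, Submodule.coe_smul, Pi.smul_apply, coe_leviEquivSB, leviOp_apply, map_zero, smul_eq_mul]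
  have hlaw := swSectionDelta_toRep_eq_mul_of_commute L e' dV hdV (tensorFrame L dW eW dV') (tensorFrame_real L dW hdW eW dV' hdV') v
    ((mpTransportLoc L e' dV hdV (tensorFrame L dW eW dV') (tensorFrame_real L dW hdW eW dV' hdV') v Γ hΓ).toMonoidHom.comp
      (s𝔻.comp (tensorEmbLoc L e dV hdV dW hdW eW e' dV' hdV' v))) _ (c : ℂ) hp0
    (commute_partner_transport L e dV hdV dW hdW eW e' dV' hdV' v Γ hΓ s𝔻 g) Φ h
  -- `L(ρ g) Φ = c⁻¹ • ω^Δ(p_g) Φ`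
  have hL : leviEquivSB (rhoLoc L (complexConj_imagUnit L) (imagUnit_ne_zero L) e dV hdV dW hdW eW e' dV' hdV' v g)
      (continuous_rhoLoc L e dV hdV dW hdW eW e' dV' hdV' v g).1 (continuous_rhoLoc L e dV hdV dW hdW eW e' dV' hdV' v g).2 Φ =
      ((c : ℂ)⁻¹) • MpPsi.toRep (localSchrodingerDelta L e' dV hdV (tensorFrame L dW eW dV') (tensorFrame_real L dW hdW eW dV' hdV') v)
          (mpTransportLoc L e' dV hdV (tensorFrame L dW eW dV') (tensorFrame_real L dW hdW eW dV' hdV') v Γ hΓ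
            (s𝔻 (partnerEmbLoc L e dV hdV dW hdW eW e' dV' hdV' v g))) Φ := by
    rw [hc Φ, smul_smul, inv_mul_cancel₀ (Units.ne_zero c), one_smul]
  rw [hL, swSectionDelta_smul, hlaw, ← mul_assoc, inv_mul_cancel₀ (Units.ne_zero c), one_mul]

set_option maxHeartbeats 800000 in -- measured (as ★ I-3a)
include hdV0 hdW0 hdV'0 hsproj in
/-- **`hωG` AT THE INSTANCE: `ω^Δ(s^Δ_B h) (L(ρ g) Φ) = L(ρ g) (ω^Δ(s^Δ_B h) Φ)`** — Weil's operators of the partner group commute with those of `H_v` (★ `commute_partner_transport`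
through `ω^Δ(p_g) = c_g • L(ρ g)`). [cite: MoeglinVignerasWaldspurger1987, Chap. 1 I.17, Chap. 2 II.6] -/
theorem toRep_transport_leviEquivSB_rhoLoc (h : UnitaryGroup.localPi L (IsCMField.complexConj L) (n + n) (hermD L e dV hdV dW hdW) v)
    (g : UnitaryGroup.localPi L (IsCMField.complexConj L) M₂ (Matrix.diagonal dV') v) (Φ : SchwartzBruhat (Fin (n' + n') → v.adicCompletion (Fp L))) :
    MpPsi.toRep (localSchrodingerDelta L e' dV hdV (tensorFrame L dW eW dV') (tensorFrame_real L dW hdW eW dV' hdV') v)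
        (((mpTransportLoc L e' dV hdV (tensorFrame L dW eW dV') (tensorFrame_real L dW hdW eW dV' hdV') v Γ hΓ).toMonoidHom.comp
          (s𝔻.comp (tensorEmbLoc L e dV hdV dW hdW eW e' dV' hdV' v))) h)
        (leviEquivSB (rhoLoc L (complexConj_imagUnit L) (imagUnit_ne_zero L) e dV hdV dW hdW eW e' dV' hdV' v g)
          (continuous_rhoLoc L e dV hdV dW hdW eW e' dV' hdV' v g).1 (continuous_rhoLoc L e dV hdV dW hdW eW e' dV' hdV' v g).2 Φ) =
      leviEquivSB (rhoLoc L (complexConj_imagUnit L) (imagUnit_ne_zero L) e dV hdV dW hdW eW e' dV' hdV' v g)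
        (continuous_rhoLoc L e dV hdV dW hdW eW e' dV' hdV' v g).1 (continuous_rhoLoc L e dV hdV dW hdW eW e' dV' hdV' v g).2
        (MpPsi.toRep (localSchrodingerDelta L e' dV hdV (tensorFrame L dW eW dV') (tensorFrame_real L dW hdW eW dV' hdV') v)
          (((mpTransportLoc L e' dV hdV (tensorFrame L dW eW dV') (tensorFrame_real L dW hdW eW dV' hdV') v Γ hΓ).toMonoidHom.comp
            (s𝔻.comp (tensorEmbLoc L e dV hdV dW hdW eW e' dV' hdV' v))) h) Φ) := by
  obtain ⟨c, hc⟩ := exists_toRep_partner_eq_smul L e dV hdV hdV0 dW hdW hdW0 eW e' dV' hdV' hdV'0 v Γ hΓ s𝔻 hsproj g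
  have hcomm := (commute_partner_transport L e dV hdV dW hdW eW e' dV' hdV' v Γ hΓ s𝔻 g h).map
    (MpPsi.toRep (localSchrodingerDelta L e' dV hdV (tensorFrame L dW eW dV') (tensorFrame_real L dW hdW eW dV' hdV') v))
  refine apply_comm_of_eq_smul _ _ hcomm.eq _ ((c : ℂ)⁻¹) (fun Ψ => ?_) Φ
  rw [hc Ψ, smul_smul, inv_mul_cancel₀ (Units.ne_zero c), one_smul]

end Summit.HodgeConjecture.HodgeConjecture.Cruxes.HLiu418.K2LiuA7ValueInstancePartnerLaws

end
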